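import Mathlib
import Summits.KontsevichZagierPeriods.Zeta5Search.ClassTypeGuardsO
import HarnessLib

/-!
# ζ(5) search — the ONE-KEY COLLINEARITY COVER KIT: the collinearity rung `casLB + 1` from a cover whose live deep classes have ONE key, any `N ≥ 3`, any parity, no moment range (DENOM-LAW D1, prover-d1 gen 24)

Cell `pub-zeta5` (HONEST FRAMING: systematic search; no irrationality claim unless certified), TRACK «DENOM-LAW» D1 prover seat (denom-prover-d1
gen 24, `HOME/denom-law/prover-d1/ATTEMPT-24.md` §4).  A corollary of LANDED theorems, no new mathematics: gen-2 g9's `collinearityCriterion_holds`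
(regime H0: if the orbit vectors of the deep classes lie on one line of `𝔽_p²` THROUGH THE ORIGIN, the first Casoratian digit vanishes,
`v_p(Cas_j(b)) ≥ casLB + 1` — no parity and no moment-range hypothesis in the through-origin case) and `ClassTypeGuardsO`'s cover reading
(`live_key_of_cover`, `line_origin_of_related`): when the check `checkO … N K K` passes — every type has exponent `≥ −N`, and every LIVE type of
exponent `−N` has the ONE key `K` (up to reversal of a centre-free type; centre-free palindromic types at even `N` are not live: their orbit vector is
`0`) — all live deep keys are related, so the deep orbit vectors lie on a line through the origin (`collinearOne_of_cover`), whence the rung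
(`rungO1_of_cover`) and its guarded form with THEOREM LB and the `checkLBx` fallback (`cover_O1_j`, the shape of `StairTS1.cover_O_j` without `N` odd
and without the range).  First consumer: the a = 5 «A5U16» region (profiles generated by (1,6) | (1,6),(4,5) | (1,6),(3,5)), where at `N = 6` the live
deep types are `(1,−6,−1) ~ (−1,−6,1)` only (the single-pole `[0,−6,0]` is centre-free palindromic, not live) — the census's CC rung in cover form.
`p`-adic valuations of the cell's own rationals; nothing about ζ(5); no γ; records in print UNMOVED.
-/

open Finset

namespace Summit.KontsevichZagierPeriods.Zeta5Search.ClassTypeCover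

open Summit.KontsevichZagierPeriods.Zeta5Search.ClusterValuation
open Summit.KontsevichZagierPeriods.Zeta5Search.CasoratianValuation (InPolytope shift casoratian)
open Summit.KontsevichZagierPeriods.Zeta5Search.WedgeDictionary (dOf)

variable {p : ℕ}

/-- **One key: a line through the origin from a cover** — if `checkO` passes with the same key twice, every live deep class has that key, all live
deep keys are related, and the deep orbit vectors lie on a line of `𝔽_p²` through the origin (`line_origin_of_related`); stated in the shape
`collinearityCriterion_holds` consumes (`e = 0`). -/
theorem collinearOne_of_cover {b : ℕ → ℤ} (hb : InPolytope b) (hpr : p.Prime) (hp5 : 5 ≤ p) (hpb : (p : ℤ) ≤ b 0)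
    (hwin : (b 0 + 2 : ℤ) < (p : ℤ) ^ 2) {TY : List (List ℤ × Bool)} (hcov : Cover b p TY) {N : ℕ} {K : Bool × List ℤ}
    (hchk : checkO (decide (¬ (2 : ℤ) ∣ b 0)) TY N K K = true) :
    ∃ a c e : ℤ, ¬ ((p : ℤ) ∣ a ∧ (p : ℤ) ∣ c) ∧ (e = 0 ∨ ((N : ℤ) - 1) * p + 2 ≤ 2 * dOf b + 3) ∧
      ∀ x ∈ deepClasses b p N, pCong p (a * orbitK b p N x + c * orbitV b p N x + e) = true := by
  haveI : Fact p.Prime := ⟨hpr⟩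
  have hkeys := fun x hx => live_key_of_cover hcov hchk (x := x) hx
  obtain ⟨a, c, hac, h⟩ := line_origin_of_related b hb hp5 hpb hwin (N := N) (fun x hx y hy => by
    rcases hkeys x hx with hxk | hxk <;> rcases hkeys y hy with hyk | hyk <;> exact sameKey_trans hyk (sameKey_symm hxk))
  exact ⟨a, c, 0, hac, Or.inl rfl, fun x hx => by simpa using h x hx⟩

/-- **The COLLINEARITY RUNG from a one-key cover**: `casLB b p + 1 ≤ v_p(Cas_j(b))` for any `N ≥ 3` (either parity, no moment range), when `−N`
is realised by a multipole class (`collinearityCriterion_holds` through the origin). -/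
theorem rungO1_of_cover {b : ℕ → ℤ} {j : ℕ} (hb : InPolytope b) (hj1 : 1 ≤ j) (hj7 : j ≤ 7) (hb' : InPolytope (shift b j))
    (hpr : p.Prime) (hp5 : 5 ≤ p) (hpb : (p : ℤ) ≤ b 0) (hpd : (p : ℤ) ≤ dOf b) (hwin : (b 0 + 2 : ℤ) < (p : ℤ) ^ 2)
    {TY : List (List ℤ × Bool)} (hcov : Cover b p TY) {N : ℕ} (hN : 3 ≤ N) {K : Bool × List ℤ}
    (hchk : checkO (decide (¬ (2 : ℤ) ∣ b 0)) TY N K K = true)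
    (hreal : ∃ x, x < p ∧ 2 ≤ classPoleCount b p x ∧ classExp b p x = -(N : ℤ)) (hcas : casoratian b j ≠ 0) :
    casLB b p + 1 ≤ padicValRat p (casoratian b j) := by
  haveI : Fact p.Prime := ⟨hpr⟩
  have hH0 : ∀ x, x < p → -(N : ℤ) ≤ classExp b p x := by
    intro x hx
    obtain ⟨tc, htc, ht⟩ := hcov x hx
    have hc := List.all_eq_true.1 (by rw [checkO] at hchk; exact hchk) tc htc
    simp only [Bool.and_eq_true, decide_eq_true_eq] at hc
    rw [ht.classExp_eq]; exact hc.1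
  obtain ⟨x, hx, h2, hE⟩ := hreal
  exact collinearityCriterion_holds b p j N hb hb' hj1 hj7 hpr hp5 hpb hpd hwin hN hH0
    ⟨x, (mem_multipoleClasses_iff b p x).2 ⟨hx, h2⟩, hE⟩ (collinearOne_of_cover hb hpr hp5 hpb hwin hcov hchk) hcas

/-- **The one-key collinearity rung for any direction `j`, guarded** (the shape of `StairTS1.cover_O_j` without the parity and range hypotheses):
`c ≤ v_p(Cas_j(b))` from a cover, `checkLB` at `(−N, B)` with `c ≤ −N + B + 1`, `checkO` at `N` with one key, and the fallback `checkLBx` at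
`(−N; A', B')` with `c ≤ A' + B'` for the case that no multipole class realises `−N`. -/
theorem cover_O1_j {b : ℕ → ℤ} {j : ℕ} (hb : InPolytope b) (hj1 : 1 ≤ j) (hj7 : j ≤ 7) (hb' : InPolytope (shift b j)) (hpr : p.Prime)
    (hp5 : 5 ≤ p) (hpb : (p : ℤ) ≤ b 0) (hpd : (p : ℤ) ≤ dOf b) (hwin : (b 0 + 2 : ℤ) < (p : ℤ) ^ 2)
    {TY : List (List ℤ × Bool)} (hcov : Cover b p TY) {N : ℕ} (hN : 3 ≤ N) {K : Bool × List ℤ} {B A' B' c : ℤ}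
    (hLB : checkLB (decide (¬ (2 : ℤ) ∣ b 0)) TY (-(N : ℤ)) B = true) (hB1 : B ≤ 1)
    (hO : checkO (decide (¬ (2 : ℤ) ∣ b 0)) TY N K K = true)
    (hLBx : checkLBx (decide (¬ (2 : ℤ) ∣ b 0)) TY (-(N : ℤ)) A' B' = true) (hB1' : B' ≤ 1)
    (hc : c ≤ -(N : ℤ) + B + 1) (hc' : c ≤ A' + B') (hc0 : c ≤ 0)
    (hne : casoratian b j ≠ 0) : c ≤ padicValRat p (casoratian b j) := by
  haveI : Fact p.Prime := ⟨hpr⟩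
  have hv := casoratianClassBound_holds b j p hb hj1 hj7 hb' hpr hp5 hwin hne
  by_cases hreal : ∃ x, x < p ∧ 2 ≤ classPoleCount b p x ∧ classExp b p x = -(N : ℤ)
  · have hO' := rungO1_of_cover hb hj1 hj7 hb' hpr hp5 hpb hpd hwin hcov hN hO hreal hne
    rcases casLB_ge_of_cover hcov hLB hB1 hpd with h0 | h
    · rw [h0] at hv; exact le_trans (by exact_mod_cast hc0) hv
    · linarith
  · rcases casLB_ge_of_cover_x hcov hLBx hB1' hpd hreal with h0 | h
    · rw [h0] at hv; exact le_trans (by exact_mod_cast hc0) hv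
    · linarith

/-- **The one-key collinearity rung in closed form**: when a multipole class realises `−N`, `checkLB` at `(−N, B)` with `B ≤ 1` and the one-key
`checkO` give `−N + B + 1 ≤ v_p(Cas_j(b))` (the `casLB = 0` escape of `casLB_ge_of_cover` is harmless: then `1 ≤ v_p` and `−N + B + 1 ≤ −1`).
(Declaration appended by d1 g25 in an APPEND-ONLY re-commit of this module — the three declarations above are byte-identical to p621439 — to
re-trigger its hub olean build, skipped by the post-commit batcher; OPS-REQUESTS R-OLEAN-3, the signature of R-OLEAN-1/2.) -/
theorem rungO1_closed_of_cover {b : ℕ → ℤ} {j : ℕ} (hb : InPolytope b) (hj1 : 1 ≤ j) (hj7 : j ≤ 7) (hb' : InPolytope (shift b j))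
    (hpr : p.Prime) (hp5 : 5 ≤ p) (hpb : (p : ℤ) ≤ b 0) (hpd : (p : ℤ) ≤ dOf b) (hwin : (b 0 + 2 : ℤ) < (p : ℤ) ^ 2)
    {TY : List (List ℤ × Bool)} (hcov : Cover b p TY) {N : ℕ} (hN : 3 ≤ N) {K : Bool × List ℤ} {B : ℤ}
    (hLB : checkLB (decide (¬ (2 : ℤ) ∣ b 0)) TY (-(N : ℤ)) B = true) (hB1 : B ≤ 1)
    (hO : checkO (decide (¬ (2 : ℤ) ∣ b 0)) TY N K K = true)
    (hreal : ∃ x, x < p ∧ 2 ≤ classPoleCount b p x ∧ classExp b p x = -(N : ℤ)) (hne : casoratian b j ≠ 0) :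
    -(N : ℤ) + B + 1 ≤ padicValRat p (casoratian b j) := by
  haveI : Fact p.Prime := ⟨hpr⟩
  have hO' := rungO1_of_cover hb hj1 hj7 hb' hpr hp5 hpb hpd hwin hcov hN hO hreal hne
  have hN3 : (3 : ℤ) ≤ N := by exact_mod_cast hN
  rcases casLB_ge_of_cover hcov hLB hB1 hpd with h0 | h
  · rw [h0] at hO'; linarith
  · linarith

end Summit.KontsevichZagierPeriods.Zeta5Search.ClassTypeCover
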